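import Summits.Ventures.MM22.Rank333.ProfileCertRoot21
import Summits.Ventures.MM22.Rank333.Lift333O478
import Summits.Ventures.MM22.Rank333.Lift333O479
import Summits.Ventures.MM22.Rank333.Lift333O484
import Summits.Ventures.MM22.Rank333.Lift333O485
import Summits.Ventures.MM22.Rank333.Lift333O486
import Summits.Ventures.MM22.Rank333.Lift333O488
import Summits.Ventures.MM22.Rank333.Lift333O489
import Summits.Ventures.MM22.Rank333.ProfileCertL494Holds
import HarnessLib

/-!
# MM22 venture — `R_𝔽₂(⟨3,3,3⟩) ≥ 21` IN THE KERNEL (event K2 of the cell's ROOT-WORDING-KIT §5)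

Cell `pub-mm22` (MatrixMultiplication venture; HOME `run/shared/lean/pub/pub-mm22/`; seat bench g6, file owner per lead g4
2026-08-23T02:46:57Z).  HONEST FRAMING: this file only PLUGS TOGETHER kernel theorems landed by other seats; it adds no
mathematics.  `rankGe21F2_of_lifts8` (p1 lineage, `ProfileCertRoot21`: the whole-root PROFILE-CERT «no 0/1 20-profile»
replayed by `decide`, its checker's soundness, Wang's printed table via p3's chain) takes the eight lifted orbit bounds of
the cell's cascade as hypotheses; seven of them are p3 g4's LP/LPDFS kernel replays `Lift333.lift_<w>` and the eighth,
`494 @ 20`, is the sub-instance PROFILE-CERT replay `ProfileCert.L494.lift494` (bench g6) with its four plane hypotheses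
discharged by p3 g4's `lift_487/488/490/491` (`ProfileCert.L494.lift494_holds`).  Result: `RankGe21F2`, i.e.
`21 ≤ tensorRank (matMulTensor (ZMod 2) 3 3 3)` — one more than Wang 2026's printed `20`; the window over `𝔽₂` becomes
`[21, 23]` (`RankGe21F2.window_F2`, LIT-2).  No summit claim (the summit is the exponent ω); this is the venture's
`⟨3,3,3⟩ / 𝔽₂` root target.
-/

set_option autoImplicit false

namespace Summit.Ventures.MM22

open Summit.MatrixMultiplication.OmegaCensus.GF2RankLB Summit.Ventures.MM22.GF2Cert
  Literature.Computability.AlgebraicComplexity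

/-- **`R_𝔽₂(⟨3,3,3⟩) ≥ 21`**: every bilinear algorithm for `3 × 3` matrix multiplication over `𝔽₂` uses at least `21`
products.  Kernel-checked assembly of the cell's certificates: the whole-root PROFILE-CERT (`rankGe21F2_of_lifts8`) with
its eight lift hypotheses discharged by the kernel replays of the cascade certificates (orbits 478 → 18; 479, 484, 485,
486, 488, 489 → 19; 494 → 20). -/
theorem rankGe21F2_holds : RankGe21F2 :=
  ProfileCert.rankGe21F2_of_lifts8 Lift333.lift_478 Lift333.lift_479 Lift333.lift_484 Lift333.lift_485
    Lift333.lift_486 Lift333.lift_488 Lift333.lift_489 ProfileCert.L494.lift494_holds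

/-- The same statement unfolded: `21 ≤ tensorRank (matMulTensor (ZMod 2) 3 3 3)`. -/
theorem twentyone_le_tensorRank_matMulTensor_three_F2 : 21 ≤ tensorRank (matMulTensor (ZMod 2) 3 3 3) :=
  rankGe21F2_holds

end Summit.Ventures.MM22
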